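import Mathlib

/-!
# ValiantsHypothesis / IntegralOrbits — `IntDetQP`, line `birth`, stub L3 (trace-form Cramer)

Support file for crux item `stmt-ValiantsHypothesis-7677`
(`Summit.ValiantsHypothesis.ValiantsHypothesis.Theses.IntegralOrbits.IntDetQP`), line `birth`,
stub `stub_traceCramer`.

The line writes left multiplication by each `M v` on `A = M_m(ℂ)` in a basis
`b : Fin m × Fin m → A`, with coordinate matrices `Cv v` (`M v * b j = ∑ i, Cv v i j • b i`), and
needs these coordinates as RATIONAL functions of traces of words.  With the Gram matrix of the
trace pairing `G i j = tr (b i * b j)` and `T v i j = tr (b i * (M v * b j))`: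

* `IntegralOrbitsIntDetQPTraceCramer.gram_mul_coord` — `G * Cv v = T v` (linearity of the trace).
* `IntegralOrbitsIntDetQPTraceCramer.det_gram_ne_zero` — `det G ≠ 0`: a kernel vector `x` of `G`
  (`Matrix.exists_mulVec_eq_zero_iff`) gives `Y = ∑ j, x j • b j` with `tr (b i * Y) = 0` for all
  `i`; a linearly independent family of `finrank` many vectors spans
  (`LinearIndependent.span_eq_top_of_card_eq_finrank'`), so `tr (E * Y) = 0` for every matrix
  `E`, and `E = Matrix.single q p 1` (`Matrix.trace_single_mul`) gives `Y p q = 0`; hence `Y = 0`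
  and `x = 0` by linear independence.
* `stub_traceCramer` — `det G ≠ 0` and `det G • Cv v = adj G * T v`
  (`Matrix.adjugate_mul : adj G * G = det G • 1`).
-/

-- `Summit.ValiantsHypothesis.ValiantsHypothesis.…` is the tree's mandated single-conjunct layout
-- (Sub = Summit), so the duplicated namespace component is intended.
set_option linter.dupNamespace false

namespace Summit.ValiantsHypothesis.ValiantsHypothesis.Theorems

namespace IntegralOrbitsIntDetQPTraceCramer

open Matrix

variable {K : Type} [Field K] {n κ : Type} [Fintype n] [Fintype κ]

/-- **Gram identity.** If `N * b j = ∑ i, C i j • b i` for all `j`, then the Gram matrix of the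
trace pairing times the coordinate matrix is the matrix of traces `tr (b i * (N * b j))`:
`G * C = T`. [folklore] -/
theorem gram_mul_coord (b : κ → Matrix n n K) (N : Matrix n n K) (C : Matrix κ κ K)
    (hC : ∀ j, N * b j = ∑ i, C i j • b i) :
    (Matrix.of fun i j : κ => (b i * b j).trace) * C =
      Matrix.of fun i j : κ => (b i * (N * b j)).trace := by
  ext i j
  simp only [Matrix.mul_apply, Matrix.of_apply, hC j, Matrix.mul_sum, Matrix.mul_smul,
    Matrix.trace_sum, Matrix.trace_smul, smul_eq_mul]
  exact Finset.sum_congr rfl fun l _ => mul_comm _ _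

/-- **Nondegeneracy of the trace form on a basis.** If `b` is a linearly independent family of
`finrank K (Matrix n n K)` many matrices, then the Gram matrix `G i j = tr (b i * b j)` of the
trace pairing has nonzero determinant. [folklore] -/
theorem det_gram_ne_zero [DecidableEq n] [DecidableEq κ] (b : κ → Matrix n n K)
    (hb : LinearIndependent K b) (hcard : Fintype.card κ = Module.finrank K (Matrix n n K)) :
    (Matrix.of fun i j : κ => (b i * b j).trace).det ≠ 0 := by
  intro hdet
  obtain ⟨x, hx0, hx⟩ := Matrix.exists_mulVec_eq_zero_iff.mpr hdet
  -- `Y := ∑ j, x j • b j` is trace-orthogonal to every `b i`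
  have hbY : ∀ i, (b i * ∑ j, x j • b j).trace = 0 := by
    intro i
    have hi := congr_fun hx i
    simp only [Matrix.mulVec, dotProduct, Matrix.of_apply, Pi.zero_apply] at hi
    simp only [Matrix.mul_sum, Matrix.mul_smul, Matrix.trace_sum, Matrix.trace_smul, smul_eq_mul]
    rw [← hi]
    exact Finset.sum_congr rfl fun l _ => mul_comm _ _
  -- hence to every matrix `E`, since `b` spans
  have hspan : Submodule.span K (Set.range b) = ⊤ := hb.span_eq_top_of_card_eq_finrank' hcard
  have hEY : ∀ E : Matrix n n K, (E * ∑ j, x j • b j).trace = 0 := by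
    intro E
    have hE : E ∈ Submodule.span K (Set.range b) := hspan ▸ Submodule.mem_top
    obtain ⟨c, rfl⟩ := (Submodule.mem_span_range_iff_exists_fun K).mp hE
    simp only [Finset.sum_mul, smul_mul_assoc, Matrix.trace_sum, Matrix.trace_smul, hbY,
      smul_zero, Finset.sum_const_zero]
  -- so `Y = 0`
  have hY0 : ∑ j, x j • b j = 0 := by
    ext p q
    have hpq := hEY (Matrix.single q p 1)
    rwa [Matrix.trace_single_mul, one_smul] at hpq
  -- contradicting the linear independence of `b`
  exact hx0 (funext fun j => Fintype.linearIndependent_iff.mp hb x hY0 j)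

end IntegralOrbitsIntDetQPTraceCramer

/-- **Stub L3 (trace-form Cramer)** for crux `IntegralOrbits.IntDetQP`, line `birth`: with
`G i j = tr (b_i b_j)` and `T_v i j = tr (b_i M_v b_j)`, linearity of the trace gives
`G * C_v = T_v`; the trace pairing on `M_m(ℂ)` is nondegenerate and `b` is a basis
(`m * m = finrank ℂ M_m(ℂ)` linearly independent matrices), so `det G ≠ 0` and
`det G • C_v = adj G * T_v` (`adj G * G = det G • 1`). [folklore] -/
theorem stub_traceCramer :
    ∀ (ι : Type) [Fintype ι] [DecidableEq ι] (m : ℕ) (M : ι → Matrix (Fin m) (Fin m) ℂ)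
      (b : Fin m × Fin m → Matrix (Fin m) (Fin m) ℂ)
      (Cv : ι → Matrix (Fin m × Fin m) (Fin m × Fin m) ℂ),
      LinearIndependent ℂ b →
      (∀ v j, M v * b j = ∑ i, Cv v i j • b i) →
      (Matrix.of fun i j : Fin m × Fin m => (b i * b j).trace).det ≠ 0 ∧
      ∀ v, (Matrix.of fun i j : Fin m × Fin m => (b i * b j).trace).det • Cv v =
        (Matrix.of fun i j : Fin m × Fin m => (b i * b j).trace).adjugate *
          Matrix.of fun i j : Fin m × Fin m => (b i * (M v * b j)).trace := by
  intro ι _ _ m M b Cv hb hC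
  refine ⟨IntegralOrbitsIntDetQPTraceCramer.det_gram_ne_zero b hb
    (by simp [Module.finrank_matrix]), fun v => ?_⟩
  rw [← IntegralOrbitsIntDetQPTraceCramer.gram_mul_coord b (M v) (Cv v) (hC v), ← Matrix.mul_assoc,
    Matrix.adjugate_mul, Matrix.smul_mul, Matrix.one_mul]

end Summit.ValiantsHypothesis.ValiantsHypothesis.Theorems
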